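import Summits.AtomisticToContinuum.Crystallization.Theorems.PricedLinkCensusTruncatedCensusGapAffineStackingLaw
import Literature.MathematicalPhysics.StatisticalMechanics.BarlowStacking

/-!
# HCP minimises the range-2 truncated Lennard-Jones energy among Barlow words (modulo the identification)

Stub `energyPerParticle_hcp_le_barlow_truncLJ_of_ident` of the line `sharp-m-potential-compactness`
for the crux `PricedLinkCensus.TruncatedCensusGap` (item stmt-AtomisticToContinuum-14230).  The
statement at the end is the registered signature VERBATIM.

Write `V_χ = min 1 (max 0 (4 - 2r)) · V_LJ` for the range-2 truncated Lennard-Jones potential.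
ASSUMING the identification "energy per particle of the periodic Barlow configuration
`barlowPeriodicConfiguration s ha hh hp hs` = period-average of `barlowSiteEnergy V_χ a h s`"
(the first hypothesis, a neighbouring stub), the affine stacking law
`barlowSiteEnergy_average_truncLJ_affine` (for `3h ≥ 2`) gives

* `e(word s) = e₀(a,h) + J₂(a,h) · alignedFrequency s p 2`, with `0 ≤ alignedFrequency s p 2 ≤ 1`;
* `e(hcp) = e₀(a,h) + J₂(a,h) · 1`, since `hcpPeriodicConfiguration ha hh` IS the Barlow
  configuration of the alternating word `alternatingHagg` (period `2`), all of whose pairs of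
  layers at distance `2` are aligned (`haggAligned_alternating_iff`).

Hence for `J₂(a,h) = barlowCoupling V_χ a h 2 ≤ 0` the hcp configuration has the least energy per
particle among all periodic Barlow words at the same `(a, h)`.
-/

noncomputable section

namespace Summit.AtomisticToContinuum.Crystallization.Theorems.PricedLinkCensusTruncatedCensusGap

open Literature.MathematicalPhysics.StatisticalMechanics
open Finset

/-! ### The aligned frequency -/

/-- The frequency of aligned pairs of layers at distance `k` in a period is at most `1`.
[folklore] -/
theorem alignedFrequency_le_one (s : ℤ → ℤ) (p k : ℕ) : alignedFrequency s p k ≤ 1 := by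
  unfold alignedFrequency
  rcases Nat.eq_zero_or_pos p with rfl | hp
  · simp
  · rw [div_le_one (by exact_mod_cast hp)]
    exact_mod_cast (card_filter_le _ _).trans (card_range p).le

/-- In the alternating (hcp) word every pair of layers at distance `2` is aligned, so the aligned
frequency at distance `2` over the period `2` is `1`. [folklore] -/
theorem alignedFrequency_alternatingHagg_two_two : alignedFrequency alternatingHagg 2 2 = 1 := by
  unfold alignedFrequency
  rw [filter_true_of_mem fun (m : ℕ) _ => (haggAligned_alternating_iff (m : ℤ) 2).2 even_two,
    card_range]
  norm_num

/-! ### The registered statement -/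

/-- **HCP minimises the `V_χ` energy per particle among periodic Barlow words at fixed `(a, h)`
when `J₂(a,h) ≤ 0` and `3h ≥ 2`, modulo the identification** of the energy per particle of a
periodic Barlow configuration with the period-average of the site energies (first hypothesis):
by the affine stacking law `e(word) = e₀ + J₂ · alignedFrequency s p 2 ≥ e₀ + J₂ · 1 = e(hcp)`.
[folklore] -/
theorem energyPerParticle_hcp_le_barlow_truncLJ_of_ident : (∀ (a h : ℝ) (s : ℤ → ℤ) (p : ℕ) (ha : a ≠ 0) (hh : h ≠ 0) (hp : p ≠ 0) (hs : ∀ i : ℤ, s (i + p) = s i), 0 < a → 0 < h → (barlowPeriodicConfiguration s ha hh hp hs).energyPerParticle (fun r => min 1 (max 0 (4 - 2 * r)) * lennardJones r) = (∑ m ∈ Finset.range p, barlowSiteEnergy (fun r => min 1 (max 0 (4 - 2 * r)) * lennardJones r) a h s m) / p) → ∀ (a h : ℝ) (s : ℤ → ℤ) (p : ℕ) (ha : a ≠ 0) (hh : h ≠ 0) (hp : p ≠ 0) (hs : ∀ i : ℤ, s (i + p) = s i), 0 < a → 2 ≤ 3 * h → IsHaggSeq s → barlowCoupling (fun r => min 1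 (max 0 (4 - 2 * r)) * lennardJones r) a h 2 ≤ 0 → (hcpPeriodicConfiguration ha hh).energyPerParticle (fun r => min 1 (max 0 (4 - 2 * r)) * lennardJones r) ≤ (barlowPeriodicConfiguration s ha hh hp hs).energyPerParticle (fun r => min 1 (max 0 (4 - 2 * r)) * lennardJones r) := by
  intro hident a h s p ha hh hp hs ha0 h3 hhs hJ
  have hh0 : 0 < h := by linarith
  -- the word: `e(word) = e₀ + J₂ · alignedFrequency s p 2`
  have hword : (barlowPeriodicConfiguration s ha hh hp hs).energyPerParticle
      (fun r => min 1 (max 0 (4 - 2 * r)) * lennardJones r) =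
      barlowBaseEnergy (fun r => min 1 (max 0 (4 - 2 * r)) * lennardJones r) a h +
        barlowCoupling (fun r => min 1 (max 0 (4 - 2 * r)) * lennardJones r) a h 2 *
          alignedFrequency s p 2 := by
    rw [hident a h s p ha hh hp hs ha0 hh0, div_eq_inv_mul]
    exact barlowSiteEnergy_average_truncLJ_affine a h s p ha0 h3 hhs hp hs
  -- hcp: the alternating word of period `2`, `e(hcp) = e₀ + J₂ · 1`
  have hhcp : (hcpPeriodicConfiguration ha hh).energyPerParticle
      (fun r => min 1 (max 0 (4 - 2 * r)) * lennardJones r) =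
      barlowBaseEnergy (fun r => min 1 (max 0 (4 - 2 * r)) * lennardJones r) a h +
        barlowCoupling (fun r => min 1 (max 0 (4 - 2 * r)) * lennardJones r) a h 2 := by
    show (barlowPeriodicConfiguration alternatingHagg ha hh two_ne_zero
      alternatingHagg_periodic).energyPerParticle
        (fun r => min 1 (max 0 (4 - 2 * r)) * lennardJones r) = _
    rw [hident a h alternatingHagg 2 ha hh two_ne_zero alternatingHagg_periodic ha0 hh0,
      div_eq_inv_mul, barlowSiteEnergy_average_truncLJ_affine a h alternatingHagg 2 ha0 h3
        isHaggSeq_alternating two_ne_zero alternatingHagg_periodic,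
      alignedFrequency_alternatingHagg_two_two, mul_one]
  rw [hword, hhcp]
  have hmono := mul_le_mul_of_nonpos_left (alignedFrequency_le_one s p 2) hJ
  rw [mul_one] at hmono
  linarith

end Summit.AtomisticToContinuum.Crystallization.Theorems.PricedLinkCensusTruncatedCensusGap
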